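import Summits.QuantumFields.YangMills.Theorems.AllWindowsColdBoxBoxHighLineTiltCum5SizesU
import Summits.QuantumFields.YangMills.Theorems.AllWindowsColdBoxBoxHighLineRestrictionSetSlots

/-!
# U5-L3-concrete on the CUT set — `κ₅,t(c_x, c_y; tiltU)` over `μ_{D′}` for a GENERAL measurable `D′ ⊆ smallField H s`, sup bound `B` a HYPOTHESIS
# (planner ym-idea-2 g18's request 2026-08-30T00:01:53Z, `Cruxes/BoxWindowHighSU2213/ASSEMBLY-U5.md` §3 (D′)/(E′); LINE-20 U5 ⟨stmt-QuantumFields-24336⟩)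

Width seat `ym-line-sfw-p2-w5` (prover-ym-line-sfw-p2-w5-g24-0).  ASSEMBLY-U5 runs the third-order tilt expansion on the CUT small field
`D′ = smallField H s ∩ {|cubicVertex| < …}` (lift L4), where `sup_{D′}|tiltU| ≤ B` (w4's ✓`…TiltSupBoundsCubicCut`, `B = 2`) replaces S5's window constraint (a);
so the `μ_D`-chain ✓`Tilt.abs_tiltCum5_muD_le` → ✓`abs_tiltCum5_muD_tiltU_le` → ✓`abs_tiltCum5_muD_le_of_sizes` (fcl-p3 g26) is re-run here for
`μ_{D′} := (volume.restrict D′).withDensity (ofReal ∘ gaussWeight β H)` in fcl-p3 g27's ✓`…RestrictionSetMoments/Slots` letters (`1_{D′} = D′.indicator 1`,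
norm transfer ✓`GaussRestrict.tiltExp_muSet_le_gaussAvg`), with the `B`-dependence EXPLICIT (`e^{4B}`):

* ★ `Tilt.abs_tiltCum5_muSet_le` — κ₅ over `μ_{D′}` by the seven restricted Gaussian moments `E·E₀[1_{D′}·Y]/E₀[1_{D′}]`, `E = e^{2tB}`;
* ★ `GaussNormalForm.abs_tiltCum5_muSet_tiltU_le` — the same along the UNtruncated `tiltU β H` (a.e.-congruence on `μ_{D′}`);
* `GaussNormalForm.k5_prefactor_le` — `32·KP·K + 28·KP²K² + 12·K³·KP ≤ 112(√C_P + C_P)·Λ²` for `K = √(2Λ)`, `KP = √(2ΛC_P)`, `Λ ≥ 1`;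
* ★★ `GaussNormalForm.abs_tiltCum5_muSet_le_of_sizes` — for `H ≥ 1`, `β ≥ 1`, `0 < s ≤ 1`, measurable `D′ ⊆ smallField H s`, `0 ≤ B`, `sup_{D′}|tiltU| ≤ B`,
  `E₀[1_{D′}] ≥ 1/2` and ANY bounds `E₀[1_{D′}(tiltU − b)^k] ≤ RU_k` (`k = 2,4,6`):
  `|κ₅,t| ≤ C·e^{4B}·[((1+log H)²/β² + s³/(β√β))·√RU₆ + (1+log H)²/β²·(√RU₂·√RU₄) + ((1+log H)²/β² + s³/(β√β))·(RU₂·√RU₂)]`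
  (the plaquette slots are dominated through `1_{D′} ≤ 1_D` by fcl-p3's ✓`gaussAvg_sfInd_mul_chartPlaqCost_sub_mean_pow_le`).
The `U`-slots over `D′` are discharged in the sequel `…TiltCum5SizesMuSetU` (monotone transfer of ✓`gaussAvg_sfInd_mul_tiltU_sub_pow_two_four_six_le`).

Tree only; no definitions; standard axioms.  HONEST LABEL: U5 prep, helper-grade; U5 ⟨24336⟩ UNSTAFFED/OPEN, ⟨24004⟩ OPEN; route AllWindowsColdBox DRAFT;
no crux, rung or summit is proved; **the Yang–Mills mass gap is NOT proved by this file; no summit is proved by a line.**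
-/

set_option autoImplicit false

noncomputable section

open MeasureTheory Set Real
open Literature.Probability.LatticeModels (Site)
open Summit.QuantumFields.YangMills.Theorems.WeakCouplingRates (plaq12At)

namespace Summit.QuantumFields.YangMills.Theorems.AllWindowsColdBoxBoxHighLine

/-! ## §1 `κ₅,t` over `μ_{D′}` through restricted Gaussian moments -/

namespace Tilt

/-- ★ **`κ₅,t` over `μ_{D′}` through restricted Gaussian moments** (general measurable `D′`): with `E = e^{2tB}` (`|U| ≤ B` on `D′`, `0 ≤ t`) and
`R(Y) = E₀[1_{D′}·Y]/E₀[1_{D′}]`, for all constants `a₁, a₂, b`, `|κ₅,t(G₁,G₂,U,U,U)|` is at most the bound of ✓`abs_tiltCum5_le_of_moments` at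
`mᵢ := E·R((Gᵢ−aᵢ)²)`, `qᵢ := E·R((Gᵢ−aᵢ)⁴)`, `u_k := E·R((U−b)^k)` (globally bounded measurable `U, G₁, G₂`; ✓`GaussRestrict.tiltExp_muSet_le_gaussAvg`). -/
theorem abs_tiltCum5_muSet_le (H : ℕ) {β : ℝ} (hβ : 0 < β) {D : Set (LandauFree H → E3)} (hDm : MeasurableSet D)
    (hD : 0 < ∫ a, D.indicator (fun _ => (1 : ℝ)) a * gaussWeight β H a)
    {U G₁ G₂ : (LandauFree H → E3) → ℝ} {BU B₁ B₂ B : ℝ} (hU : Measurable U) (h₁ : Measurable G₁) (h₂ : Measurable G₂)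
    (hUb : ∀ a, |U a| ≤ BU) (h₁b : ∀ a, |G₁ a| ≤ B₁) (h₂b : ∀ a, |G₂ a| ≤ B₂) (hUD : ∀ a ∈ D, |U a| ≤ B)
    {t : ℝ} (ht : 0 ≤ t) (a₁ a₂ b : ℝ) :
    |tiltCum5 (((volume : Measure (LandauFree H → E3)).restrict D).withDensity fun a => ENNReal.ofReal (gaussWeight β H a)) U t G₁ G₂| ≤
      Real.sqrt (Real.sqrt (16 * (Real.exp (2 * t * B) *
              (gaussAvg β H (fun a => D.indicator (fun _ => (1 : ℝ)) a * (G₁ a - a₁) ^ 4) / gaussAvg β H (D.indicator (fun _ => (1 : ℝ)))))) *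
            Real.sqrt (16 * (Real.exp (2 * t * B) *
              (gaussAvg β H (fun a => D.indicator (fun _ => (1 : ℝ)) a * (G₂ a - a₂) ^ 4) / gaussAvg β H (D.indicator (fun _ => (1 : ℝ))))))) *
          Real.sqrt (64 * (Real.exp (2 * t * B) *
            (gaussAvg β H (fun a => D.indicator (fun _ => (1 : ℝ)) a * (U a - b) ^ 6) / gaussAvg β H (D.indicator (fun _ => (1 : ℝ)))))) +
        Real.sqrt (Real.exp (2 * t * B) * (gaussAvg β H (fun a => D.indicator (fun _ => (1 : ℝ)) a * (G₁ a - a₁) ^ 2) /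
              gaussAvg β H (D.indicator (fun _ => (1 : ℝ))))) *
            Real.sqrt (Real.exp (2 * t * B) * (gaussAvg β H (fun a => D.indicator (fun _ => (1 : ℝ)) a * (G₂ a - a₂) ^ 2) /
              gaussAvg β H (D.indicator (fun _ => (1 : ℝ))))) *
          (Real.sqrt (Real.exp (2 * t * B) * (gaussAvg β H (fun a => D.indicator (fun _ => (1 : ℝ)) a * (U a - b) ^ 2) /
              gaussAvg β H (D.indicator (fun _ => (1 : ℝ))))) *
            Real.sqrt (16 * (Real.exp (2 * t * B) *
              (gaussAvg β H (fun a => D.indicator (fun _ => (1 : ℝ)) a * (U a - b) ^ 4) / gaussAvg β H (D.indicator (fun _ => (1 : ℝ))))))) +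
        3 * (Real.sqrt (Real.exp (2 * t * B) * (gaussAvg β H (fun a => D.indicator (fun _ => (1 : ℝ)) a * (G₁ a - a₁) ^ 2) /
                gaussAvg β H (D.indicator (fun _ => (1 : ℝ))))) *
              Real.sqrt (Real.exp (2 * t * B) * (gaussAvg β H (fun a => D.indicator (fun _ => (1 : ℝ)) a * (U a - b) ^ 2) /
                gaussAvg β H (D.indicator (fun _ => (1 : ℝ))))) *
            (Real.sqrt (Real.exp (2 * t * B) * (gaussAvg β H (fun a => D.indicator (fun _ => (1 : ℝ)) a * (G₂ a - a₂) ^ 2) /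
                gaussAvg β H (D.indicator (fun _ => (1 : ℝ))))) *
              Real.sqrt (16 * (Real.exp (2 * t * B) *
                (gaussAvg β H (fun a => D.indicator (fun _ => (1 : ℝ)) a * (U a - b) ^ 4) / gaussAvg β H (D.indicator (fun _ => (1 : ℝ)))))))) +
        3 * (Real.sqrt (Real.exp (2 * t * B) * (gaussAvg β H (fun a => D.indicator (fun _ => (1 : ℝ)) a * (G₂ a - a₂) ^ 2) /
                gaussAvg β H (D.indicator (fun _ => (1 : ℝ))))) *
              Real.sqrt (Real.exp (2 * t * B) * (gaussAvg β H (fun a => D.indicator (fun _ => (1 : ℝ)) a * (U a - b) ^ 2) /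
                gaussAvg β H (D.indicator (fun _ => (1 : ℝ))))) *
            (Real.sqrt (Real.exp (2 * t * B) * (gaussAvg β H (fun a => D.indicator (fun _ => (1 : ℝ)) a * (G₁ a - a₁) ^ 2) /
                gaussAvg β H (D.indicator (fun _ => (1 : ℝ))))) *
              Real.sqrt (16 * (Real.exp (2 * t * B) *
                (gaussAvg β H (fun a => D.indicator (fun _ => (1 : ℝ)) a * (U a - b) ^ 4) / gaussAvg β H (D.indicator (fun _ => (1 : ℝ)))))))) +
        3 * (Real.exp (2 * t * B) * (gaussAvg β H (fun a => D.indicator (fun _ => (1 : ℝ)) a * (U a - b) ^ 2) /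
              gaussAvg β H (D.indicator (fun _ => (1 : ℝ)))) *
            (Real.sqrt (Real.sqrt (16 * (Real.exp (2 * t * B) *
                    (gaussAvg β H (fun a => D.indicator (fun _ => (1 : ℝ)) a * (G₁ a - a₁) ^ 4) / gaussAvg β H (D.indicator (fun _ => (1 : ℝ)))))) *
                  Real.sqrt (16 * (Real.exp (2 * t * B) *
                    (gaussAvg β H (fun a => D.indicator (fun _ => (1 : ℝ)) a * (G₂ a - a₂) ^ 4) / gaussAvg β H (D.indicator (fun _ => (1 : ℝ))))))) *
              Real.sqrt (Real.exp (2 * t * B) *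
                (gaussAvg β H (fun a => D.indicator (fun _ => (1 : ℝ)) a * (U a - b) ^ 2) / gaussAvg β H (D.indicator (fun _ => (1 : ℝ))))))) := by
  haveI := GaussRestrict.isFiniteMeasure_muSet (H := H) hβ D
  haveI := GaussRestrict.neZero_muSet (H := H) hβ hDm hD
  have c₁ : ∀ a, |G₁ a - a₁| ≤ B₁ + |a₁| := fun a => (abs_sub _ _).trans (add_le_add (h₁b a) le_rfl)
  have c₂ : ∀ a, |G₂ a - a₂| ≤ B₂ + |a₂| := fun a => (abs_sub _ _).trans (add_le_add (h₂b a) le_rfl)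
  have cU : ∀ a, |U a - b| ≤ BU + |b| := fun a => (abs_sub _ _).trans (add_le_add (hUb a) le_rfl)
  have hm₁ : Measurable fun a => G₁ a - a₁ := h₁.sub measurable_const
  have hm₂ : Measurable fun a => G₂ a - a₂ := h₂.sub measurable_const
  have hmU : Measurable fun a => U a - b := hU.sub measurable_const
  have e6 : ∀ a, 0 ≤ (U a - b) ^ 6 := fun a => by positivity
  have e4U : ∀ a, 0 ≤ (U a - b) ^ 4 := fun a => by positivity
  have e4₁ : ∀ a, 0 ≤ (G₁ a - a₁) ^ 4 := fun a => by positivity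
  have e4₂ : ∀ a, 0 ≤ (G₂ a - a₂) ^ 4 := fun a => by positivity
  have t₁ := GaussRestrict.tiltExp_muSet_le_gaussAvg hβ hDm hD ht hU hUD (fun a => sq_nonneg (G₁ a - a₁))
    (integrable_bdd_mul_gaussWeight H hβ (hm₁.pow_const 2) (abs_pow_le_pow c₁ 2))
  have t₂ := GaussRestrict.tiltExp_muSet_le_gaussAvg hβ hDm hD ht hU hUD (fun a => sq_nonneg (G₂ a - a₂))
    (integrable_bdd_mul_gaussWeight H hβ (hm₂.pow_const 2) (abs_pow_le_pow c₂ 2))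
  have q₁ := GaussRestrict.tiltExp_muSet_le_gaussAvg hβ hDm hD ht hU hUD (fun a => e4₁ a)
    (integrable_bdd_mul_gaussWeight H hβ (hm₁.pow_const 4) (abs_pow_le_pow c₁ 4))
  have q₂ := GaussRestrict.tiltExp_muSet_le_gaussAvg hβ hDm hD ht hU hUD (fun a => e4₂ a)
    (integrable_bdd_mul_gaussWeight H hβ (hm₂.pow_const 4) (abs_pow_le_pow c₂ 4))
  have u₂ := GaussRestrict.tiltExp_muSet_le_gaussAvg hβ hDm hD ht hU hUD (fun a => sq_nonneg (U a - b))
    (integrable_bdd_mul_gaussWeight H hβ (hmU.pow_const 2) (abs_pow_le_pow cU 2))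
  have u₄ := GaussRestrict.tiltExp_muSet_le_gaussAvg hβ hDm hD ht hU hUD (fun a => e4U a)
    (integrable_bdd_mul_gaussWeight H hβ (hmU.pow_const 4) (abs_pow_le_pow cU 4))
  have u₆ := GaussRestrict.tiltExp_muSet_le_gaussAvg hβ hDm hD ht hU hUD (fun a => e6 a)
    (integrable_bdd_mul_gaussWeight H hβ (hmU.pow_const 6) (abs_pow_le_pow cU 6))
  exact abs_tiltCum5_le_of_moments hU h₁ h₂ hUb h₁b h₂b t a₁ a₂ b t₁ t₂ q₁ q₂ u₂ u₄ u₆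

end Tilt

/-! ## §2 Along the untruncated tilt `tiltU β H` -/

namespace GaussNormalForm

variable {H : ℕ}

/-- ★ **`κ₅,t(c_x, c_y; tiltU)` over `μ_{D′}` through restricted Gaussian moments of the UNtruncated observables**: for a measurable `D′`,
`sup_{D′} |tiltU β H| ≤ B` (`0 ≤ B`), `∫ 1_{D′}·gaussWeight > 0`, `0 ≤ t` and all constants `a₁ a₂ b`. -/
theorem abs_tiltCum5_muSet_tiltU_le {β : ℝ} (hβ : 0 < β) {D : Set (LandauFree H → E3)} (hDm : MeasurableSet D)
    (hD : 0 < ∫ a, D.indicator (fun _ => (1 : ℝ)) a * gaussWeight β H a)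
    {B : ℝ} (hB : 0 ≤ B) (hUD : ∀ a ∈ D, |tiltU β H a| ≤ B) {t : ℝ} (ht : 0 ≤ t) (x y : Site 4) (a₁ a₂ b : ℝ) :
    |Tilt.tiltCum5 (((volume : Measure (LandauFree H → E3)).restrict D).withDensity fun a => ENNReal.ofReal (gaussWeight β H a))
        (tiltU β H) t (chartPlaqCost H x 1 2) (chartPlaqCost H y 1 2)| ≤
      Real.sqrt (Real.sqrt (16 * (Real.exp (2 * t * B) *
              (gaussAvg β H (fun a => D.indicator (fun _ => (1 : ℝ)) a * (chartPlaqCost H x 1 2 a - a₁) ^ 4) / gaussAvg β H (D.indicator (fun _ => (1 : ℝ)))))) *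
            Real.sqrt (16 * (Real.exp (2 * t * B) *
              (gaussAvg β H (fun a => D.indicator (fun _ => (1 : ℝ)) a * (chartPlaqCost H y 1 2 a - a₂) ^ 4) / gaussAvg β H (D.indicator (fun _ => (1 : ℝ))))))) *
          Real.sqrt (64 * (Real.exp (2 * t * B) *
            (gaussAvg β H (fun a => D.indicator (fun _ => (1 : ℝ)) a * (tiltU β H a - b) ^ 6) / gaussAvg β H (D.indicator (fun _ => (1 : ℝ)))))) +
        Real.sqrt (Real.exp (2 * t * B) * (gaussAvg β H (fun a => D.indicator (fun _ => (1 : ℝ)) a * (chartPlaqCost H x 1 2 a - a₁) ^ 2) /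
              gaussAvg β H (D.indicator (fun _ => (1 : ℝ))))) *
            Real.sqrt (Real.exp (2 * t * B) * (gaussAvg β H (fun a => D.indicator (fun _ => (1 : ℝ)) a * (chartPlaqCost H y 1 2 a - a₂) ^ 2) /
              gaussAvg β H (D.indicator (fun _ => (1 : ℝ))))) *
          (Real.sqrt (Real.exp (2 * t * B) * (gaussAvg β H (fun a => D.indicator (fun _ => (1 : ℝ)) a * (tiltU β H a - b) ^ 2) /
              gaussAvg β H (D.indicator (fun _ => (1 : ℝ))))) *
            Real.sqrt (16 * (Real.exp (2 * t * B) *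
              (gaussAvg β H (fun a => D.indicator (fun _ => (1 : ℝ)) a * (tiltU β H a - b) ^ 4) / gaussAvg β H (D.indicator (fun _ => (1 : ℝ))))))) +
        3 * (Real.sqrt (Real.exp (2 * t * B) * (gaussAvg β H (fun a => D.indicator (fun _ => (1 : ℝ)) a * (chartPlaqCost H x 1 2 a - a₁) ^ 2) /
                gaussAvg β H (D.indicator (fun _ => (1 : ℝ))))) *
              Real.sqrt (Real.exp (2 * t * B) * (gaussAvg β H (fun a => D.indicator (fun _ => (1 : ℝ)) a * (tiltU β H a - b) ^ 2) /
                gaussAvg β H (D.indicator (fun _ => (1 : ℝ))))) *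
            (Real.sqrt (Real.exp (2 * t * B) * (gaussAvg β H (fun a => D.indicator (fun _ => (1 : ℝ)) a * (chartPlaqCost H y 1 2 a - a₂) ^ 2) /
                gaussAvg β H (D.indicator (fun _ => (1 : ℝ))))) *
              Real.sqrt (16 * (Real.exp (2 * t * B) *
                (gaussAvg β H (fun a => D.indicator (fun _ => (1 : ℝ)) a * (tiltU β H a - b) ^ 4) / gaussAvg β H (D.indicator (fun _ => (1 : ℝ)))))))) +
        3 * (Real.sqrt (Real.exp (2 * t * B) * (gaussAvg β H (fun a => D.indicator (fun _ => (1 : ℝ)) a * (chartPlaqCost H y 1 2 a - a₂) ^ 2) /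
                gaussAvg β H (D.indicator (fun _ => (1 : ℝ))))) *
              Real.sqrt (Real.exp (2 * t * B) * (gaussAvg β H (fun a => D.indicator (fun _ => (1 : ℝ)) a * (tiltU β H a - b) ^ 2) /
                gaussAvg β H (D.indicator (fun _ => (1 : ℝ))))) *
            (Real.sqrt (Real.exp (2 * t * B) * (gaussAvg β H (fun a => D.indicator (fun _ => (1 : ℝ)) a * (chartPlaqCost H x 1 2 a - a₁) ^ 2) /
                gaussAvg β H (D.indicator (fun _ => (1 : ℝ))))) *
              Real.sqrt (16 * (Real.exp (2 * t * B) *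
                (gaussAvg β H (fun a => D.indicator (fun _ => (1 : ℝ)) a * (tiltU β H a - b) ^ 4) / gaussAvg β H (D.indicator (fun _ => (1 : ℝ)))))))) +
        3 * (Real.exp (2 * t * B) * (gaussAvg β H (fun a => D.indicator (fun _ => (1 : ℝ)) a * (tiltU β H a - b) ^ 2) /
              gaussAvg β H (D.indicator (fun _ => (1 : ℝ)))) *
            (Real.sqrt (Real.sqrt (16 * (Real.exp (2 * t * B) *
                    (gaussAvg β H (fun a => D.indicator (fun _ => (1 : ℝ)) a * (chartPlaqCost H x 1 2 a - a₁) ^ 4) /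
                      gaussAvg β H (D.indicator (fun _ => (1 : ℝ)))))) *
                  Real.sqrt (16 * (Real.exp (2 * t * B) *
                    (gaussAvg β H (fun a => D.indicator (fun _ => (1 : ℝ)) a * (chartPlaqCost H y 1 2 a - a₂) ^ 4) /
                      gaussAvg β H (D.indicator (fun _ => (1 : ℝ))))))) *
              Real.sqrt (Real.exp (2 * t * B) *
                (gaussAvg β H (fun a => D.indicator (fun _ => (1 : ℝ)) a * (tiltU β H a - b) ^ 2) / gaussAvg β H (D.indicator (fun _ => (1 : ℝ))))))) := by
  haveI := GaussRestrict.isFiniteMeasure_muSet (H := H) hβ D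
  haveI := GaussRestrict.neZero_muSet (H := H) hβ hDm hD
  have hmU : Measurable (D.indicator (tiltU β H)) := (measurable_tiltU β H).indicator hDm
  have hUb : ∀ a, |D.indicator (tiltU β H) a| ≤ B := fun a => Tilt.abs_indicator_le hB hUD a
  have hUD' : ∀ a ∈ D, |D.indicator (tiltU β H) a| ≤ B := fun a _ => hUb a
  have hm₁ : Measurable (chartPlaqCost H x 1 2) := EdgeChartGaussian.measurable_chartPlaqCost H x 1 2
  have hm₂ : Measurable (chartPlaqCost H y 1 2) := EdgeChartGaussian.measurable_chartPlaqCost H y 1 2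
  have h₁b : ∀ a, |chartPlaqCost H x 1 2 a| ≤ 4 := fun a => TiltSup.abs_chartPlaqCost_le_four (H := H) x 1 2 a
  have h₂b : ∀ a, |chartPlaqCost H y 1 2 a| ≤ 4 := fun a => TiltSup.abs_chartPlaqCost_le_four (H := H) y 1 2 a
  have hae := Tilt.indicator_ae_eq_of_ae_mem (GaussRestrict.ae_muSet_mem (H := H) β hDm) (tiltU β H)
  rw [← Tilt.tiltCum5_congr_ae hae (Filter.EventuallyEq.refl _ (chartPlaqCost H x 1 2)) (Filter.EventuallyEq.refl _ (chartPlaqCost H y 1 2)) t]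
  have h := Tilt.abs_tiltCum5_muSet_le H hβ hDm hD hmU hm₁ hm₂ hUb h₁b h₂b hUD' ht a₁ a₂ b
  have e2 : (fun a => D.indicator (fun _ => (1 : ℝ)) a * (D.indicator (tiltU β H) a - b) ^ 2) =
      fun a => D.indicator (fun _ => (1 : ℝ)) a * (tiltU β H a - b) ^ 2 :=
    GaussRestrict.indicator_one_mul_congr_on fun a ha => by rw [Set.indicator_of_mem ha]
  have e4 : (fun a => D.indicator (fun _ => (1 : ℝ)) a * (D.indicator (tiltU β H) a - b) ^ 4) =
      fun a => D.indicator (fun _ => (1 : ℝ)) a * (tiltU β H a - b) ^ 4 :=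
    GaussRestrict.indicator_one_mul_congr_on fun a ha => by rw [Set.indicator_of_mem ha]
  have e6 : (fun a => D.indicator (fun _ => (1 : ℝ)) a * (D.indicator (tiltU β H) a - b) ^ 6) =
      fun a => D.indicator (fun _ => (1 : ℝ)) a * (tiltU β H a - b) ^ 6 :=
    GaussRestrict.indicator_one_mul_congr_on fun a ha => by rw [Set.indicator_of_mem ha]
  rw [e2, e4, e6] at h
  exact h

/-! ## §3 The fifth cumulant over `μ_{D′}` in sizes, modulo the three `U`-slots, `B` explicit -/

/-- The prefactor of the collapsed bound: for `Λ ≥ 1`, `C_P ≥ 0`, `K = √(2Λ)`, `KP = √(2ΛC_P)`: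
`32·KP·K + 28·KP²·K² + 12·K³·KP ≤ 112·(√C_P + C_P)·Λ²`. -/
theorem k5_prefactor_le {Λ C_P K KP : ℝ} (hΛ : 1 ≤ Λ) (hC : 0 ≤ C_P) (hK : K = Real.sqrt (2 * Λ)) (hKP : KP = Real.sqrt (2 * Λ * C_P)) :
    32 * KP * K + 28 * KP ^ 2 * K ^ 2 + 12 * K ^ 3 * KP ≤ 112 * (Real.sqrt C_P + C_P) * Λ ^ 2 := by
  have hΛ0 : 0 ≤ Λ := zero_le_one.trans hΛ
  have hK2 : K ^ 2 = 2 * Λ := by rw [hK]; exact Real.sq_sqrt (by positivity)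
  have hKP2 : KP ^ 2 = 2 * Λ * C_P := by rw [hKP]; exact Real.sq_sqrt (by positivity)
  have hKKP : KP * K = 2 * Λ * Real.sqrt C_P := by
    rw [hK, hKP, ← Real.sqrt_mul (by positivity), show 2 * Λ * C_P * (2 * Λ) = (2 * Λ) ^ 2 * C_P by ring,
      Real.sqrt_mul (by positivity), Real.sqrt_sq (by positivity)]
  have e1 : 32 * KP * K = 64 * Λ * Real.sqrt C_P := by rw [mul_assoc, hKKP]; ring
  have e2 : 28 * KP ^ 2 * K ^ 2 = 112 * Λ ^ 2 * C_P := by rw [hKP2, hK2]; ring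
  have e3 : 12 * K ^ 3 * KP = 48 * Λ ^ 2 * Real.sqrt C_P := by
    rw [show 12 * K ^ 3 * KP = 12 * K ^ 2 * (KP * K) by ring, hK2, hKKP]; ring
  rw [e1, e2, e3]
  have hs0 : 0 ≤ Real.sqrt C_P := Real.sqrt_nonneg _
  have hΛ2 : Λ ≤ Λ ^ 2 := by nlinarith
  nlinarith [mul_le_mul_of_nonneg_right hΛ2 hs0, mul_nonneg hΛ0 hs0, mul_nonneg (sq_nonneg Λ) hC]

/-- ★★ **`κ₅,t(c_x, c_y; tiltU)` over `μ_{D′}` in SIZES, modulo the `U`-slots, `B` explicit**: for `H ≥ 1`, `β ≥ 1`, `0 < s ≤ 1`, a measurable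
`D′ ⊆ smallField H s`, `0 ≤ B`, `sup_{D′}|tiltU| ≤ B`, `E₀[1_{D′}] ≥ 1/2` and any bounds `E₀[1_{D′}(tiltU − b)^k] ≤ RU_k` (`k = 2,4,6`), for all sites `x, y`
and `t ∈ [0,1]`:
`|κ₅,t| ≤ C·e^{4B}·[((1+log H)²/β² + s³/(β√β))·√RU₆ + (1+log H)²/β²·(√RU₂·√RU₄) + ((1+log H)²/β² + s³/(β√β))·(RU₂·√RU₂)]`. -/
theorem abs_tiltCum5_muSet_le_of_sizes : ∃ C : ℝ, 0 ≤ C ∧ ∀ H : ℕ, 1 ≤ H → ∀ β : ℝ, 1 ≤ β → ∀ s : ℝ, 0 < s → s ≤ 1 →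
    ∀ D : Set (LandauFree H → E3), MeasurableSet D → D ⊆ smallField H s → ∀ B : ℝ, 0 ≤ B →
    (∀ a ∈ D, |tiltU β H a| ≤ B) → 1 / 2 ≤ gaussAvg β H (D.indicator fun _ => (1 : ℝ)) →
    ∀ b RU2 RU4 RU6 : ℝ, 0 ≤ RU2 → 0 ≤ RU4 → 0 ≤ RU6 →
      gaussAvg β H (fun a => D.indicator (fun _ => (1 : ℝ)) a * (tiltU β H a - b) ^ 2) ≤ RU2 →
      gaussAvg β H (fun a => D.indicator (fun _ => (1 : ℝ)) a * (tiltU β H a - b) ^ 4) ≤ RU4 →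
      gaussAvg β H (fun a => D.indicator (fun _ => (1 : ℝ)) a * (tiltU β H a - b) ^ 6) ≤ RU6 →
    ∀ (x y : Site 4), ∀ t ∈ Set.Icc (0 : ℝ) 1,
      |Tilt.tiltCum5 (((volume : Measure (LandauFree H → E3)).restrict D).withDensity fun a => ENNReal.ofReal (gaussWeight β H a))
          (tiltU β H) t (chartPlaqCost H x 1 2) (chartPlaqCost H y 1 2)| ≤
        C * Real.exp (4 * B) * (((1 + Real.log H) ^ 2 / β ^ 2 + s ^ 3 / (β * Real.sqrt β)) * Real.sqrt RU6 +
              (1 + Real.log H) ^ 2 / β ^ 2 * (Real.sqrt RU2 * Real.sqrt RU4) +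
              ((1 + Real.log H) ^ 2 / β ^ 2 + s ^ 3 / (β * Real.sqrt β)) * (RU2 * Real.sqrt RU2)) := by
  obtain ⟨C_P, hC_P0, hP⟩ := gaussAvg_sfInd_mul_chartPlaqCost_sub_mean_pow_le
  refine ⟨112 * (Real.sqrt C_P + C_P), by positivity,
    fun H hH β hβ s hs0 hs1 D hDm hDs B hB0 hUB hD b RU2 RU4 RU6 h20 h40 h60 hR2 hR4 hR6 x y t ht => ?_⟩
  obtain ⟨ht0, ht1⟩ := ht
  have hH1 : (1 : ℝ) ≤ H := by exact_mod_cast hH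
  have hβ0 : 0 < β := lt_of_lt_of_le one_pos hβ
  -- `Λ = e^{2B}`, `K = √(2Λ)`, `KP = √(2ΛC_P)`
  obtain ⟨Λ, hΛ⟩ : ∃ Λ : ℝ, Λ = Real.exp (2 * B) := ⟨_, rfl⟩
  have hΛ1 : 1 ≤ Λ := by rw [hΛ]; exact Real.one_le_exp (by positivity)
  have hΛ0 : 0 ≤ Λ := zero_le_one.trans hΛ1
  obtain ⟨K, hKdef⟩ : ∃ K : ℝ, K = Real.sqrt (2 * Λ) := ⟨_, rfl⟩
  obtain ⟨KP, hKPdef⟩ : ∃ KP : ℝ, KP = Real.sqrt (2 * Λ * C_P) := ⟨_, rfl⟩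
  have hK0 : 0 ≤ K := by rw [hKdef]; exact Real.sqrt_nonneg _
  have hKP0 : 0 ≤ KP := by rw [hKPdef]; exact Real.sqrt_nonneg _
  have hK2 : K ^ 2 = 2 * Λ := by rw [hKdef]; exact Real.sq_sqrt (by positivity)
  have hKP2 : KP ^ 2 = 2 * Λ * C_P := by rw [hKPdef]; exact Real.sq_sqrt (by positivity)
  -- `0 < ∫ 1_D·gaussWeight`
  have hZ := EdgeChartGaussian.integral_gaussWeight_pos H hβ0
  have hDpos : 0 < ∫ a, D.indicator (fun _ => (1 : ℝ)) a * gaussWeight β H a := by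
    have e : gaussAvg β H (D.indicator fun _ => (1 : ℝ)) * ∫ a : LandauFree H → E3, gaussWeight β H a =
        ∫ a, D.indicator (fun _ => (1 : ℝ)) a * gaussWeight β H a := by
      unfold gaussAvg; rw [div_mul_cancel₀ _ hZ.ne']
    rw [← e]; exact mul_pos (lt_of_lt_of_le (by norm_num) hD) hZ
  -- indicator facts
  have hind : ∀ a, 0 ≤ D.indicator (fun _ => (1 : ℝ)) a ∧ D.indicator (fun _ => (1 : ℝ)) a ≤ sfInd H s a := by
    intro a
    by_cases ha : a ∈ D
    · rw [Set.indicator_of_mem ha, sfInd, Set.indicator_of_mem (hDs ha)]; norm_num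
    · rw [Set.indicator_of_notMem ha]; exact ⟨le_rfl, (TiltSup.sfInd_nonneg_le_one (H := H) s a).1⟩
  -- the two size parameters
  have hA0 : 0 ≤ (1 + Real.log (H : ℝ)) ^ 2 / β ^ 2 := by positivity
  have hSg0 : 0 ≤ s ^ 3 / (β * Real.sqrt β) := by positivity
  have hA2 : ((1 + Real.log (H : ℝ)) ^ 2 / β ^ 2) ^ 2 = (1 + Real.log (H : ℝ)) ^ 4 / β ^ 4 := by ring
  have hSg2 : (s ^ 3 / (β * Real.sqrt β)) ^ 2 = s ^ 6 / β ^ 3 := by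
    rw [div_pow, mul_pow, Real.sq_sqrt hβ0.le]; ring
  -- plaquette slots on `D`, dominated through `1_D ≤ sfInd`
  obtain ⟨hP2x, hP4x⟩ := hP H hH β hβ s hs0.le hs1 x
  obtain ⟨hP2y, hP4y⟩ := hP H hH β hβ s hs0.le hs1 y
  have hmono : ∀ (z : Site 4) (n : ℕ), Even n →
      gaussAvg β H (fun a => D.indicator (fun _ => (1 : ℝ)) a * (chartPlaqCost H z 1 2 a - gaussAvg β H (linCurvSq H (plaq12At z))) ^ n) ≤
        gaussAvg β H (fun a => sfInd H s a * (chartPlaqCost H z 1 2 a - gaussAvg β H (linCurvSq H (plaq12At z))) ^ n) := by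
    intro z n hn
    have hbd : ∀ a, |chartPlaqCost H z 1 2 a - gaussAvg β H (linCurvSq H (plaq12At z))| ≤ 4 + |gaussAvg β H (linCurvSq H (plaq12At z))| :=
      fun a => (abs_sub _ _).trans (add_le_add (TiltSup.abs_chartPlaqCost_le_four (H := H) z 1 2 a) le_rfl)
    have hY : Measurable fun a => sfInd H s a * (chartPlaqCost H z 1 2 a - gaussAvg β H (linCurvSq H (plaq12At z))) ^ n :=
      (Tilt.measurable_sfInd H s).mul (((EdgeChartGaussian.measurable_chartPlaqCost H z 1 2).sub measurable_const).pow_const n)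
    have hYb : ∀ a, |sfInd H s a * (chartPlaqCost H z 1 2 a - gaussAvg β H (linCurvSq H (plaq12At z))) ^ n| ≤
        (4 + |gaussAvg β H (linCurvSq H (plaq12At z))|) ^ n := by
      intro a
      rw [abs_mul, abs_of_nonneg (TiltSup.sfInd_nonneg_le_one (H := H) s a).1]
      calc sfInd H s a * |(chartPlaqCost H z 1 2 a - gaussAvg β H (linCurvSq H (plaq12At z))) ^ n|
          ≤ 1 * |(chartPlaqCost H z 1 2 a - gaussAvg β H (linCurvSq H (plaq12At z))) ^ n| :=
            mul_le_mul_of_nonneg_right (TiltSup.sfInd_nonneg_le_one (H := H) s a).2 (abs_nonneg _)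
        _ ≤ (4 + |gaussAvg β H (linCurvSq H (plaq12At z))|) ^ n := by rw [one_mul]; exact Tilt.abs_pow_le_pow hbd n a
    refine EdgeChartGaussian.gaussAvg_mono_of_nonneg H hβ0 (fun a => mul_nonneg (hind a).1 (hn.pow_nonneg _))
      (fun a => mul_le_mul_of_nonneg_right (hind a).2 (hn.pow_nonneg _)) (Tilt.integrable_bdd_mul_gaussWeight H hβ0 hY hYb)
  have ev2 : Even 2 := by decide
  have ev4 : Even 4 := by decide
  have ev6 : Even 6 := by decide
  -- `e^{2tB}·(X/E₀[1_D]) ≤ Λ·(2S)` whenever `0 ≤ X ≤ S`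
  have hEle : Real.exp (2 * t * B) ≤ Λ := by rw [hΛ]; exact Real.exp_le_exp.2 (by nlinarith)
  have step : ∀ {X S : ℝ}, 0 ≤ X → X ≤ S → Real.exp (2 * t * B) * (X / gaussAvg β H (D.indicator fun _ => (1 : ℝ))) ≤ Λ * (2 * S) := by
    intro X S hX hXS
    have h1 : X / gaussAvg β H (D.indicator fun _ => (1 : ℝ)) ≤ 2 * X := div_le_two_mul_of_half_le hX hD
    have h2 : 0 ≤ X / gaussAvg β H (D.indicator fun _ => (1 : ℝ)) := div_nonneg hX (le_trans (by norm_num) hD)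
    exact mul_le_mul hEle (by linarith) h2 hΛ0
  have n2 : ∀ (G : (LandauFree H → E3) → ℝ) (r : ℝ) {n : ℕ}, Even n → 0 ≤ gaussAvg β H (fun a => D.indicator (fun _ => (1 : ℝ)) a * (G a - r) ^ n) :=
    fun G r n hn => EdgeChartGaussian.gaussAvg_nonneg H hβ0 fun a => mul_nonneg (hind a).1 (hn.pow_nonneg _)
  have eM : Λ * (2 * (C_P * (1 + Real.log H) ^ 2 / β ^ 2)) = KP ^ 2 * ((1 + Real.log (H : ℝ)) ^ 2 / β ^ 2) := by rw [hKP2]; ring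
  have eQ : Λ * (2 * (C_P * ((1 + Real.log H) ^ 4 / β ^ 4 + s ^ 6 / β ^ 3))) =
      KP ^ 2 * ((1 + Real.log (H : ℝ)) ^ 2 / β ^ 2) ^ 2 + KP ^ 2 * (s ^ 3 / (β * Real.sqrt β)) ^ 2 := by
    rw [hKP2, hA2, hSg2]; ring
  have eU2 : Λ * (2 * RU2) = K ^ 2 * Real.sqrt RU2 ^ 2 := by rw [hK2, Real.sq_sqrt h20]; ring
  have eU4 : Λ * (2 * RU4) = K ^ 2 * RU4 := by rw [hK2]; ring
  have eU6 : Λ * (2 * RU6) = K ^ 2 * RU6 := by rw [hK2]; ring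
  have r2x := (step (n2 (chartPlaqCost H x 1 2) (gaussAvg β H (linCurvSq H (plaq12At x))) ev2) ((hmono x 2 ev2).trans hP2x)).trans_eq eM
  have r2y := (step (n2 (chartPlaqCost H y 1 2) (gaussAvg β H (linCurvSq H (plaq12At y))) ev2) ((hmono y 2 ev2).trans hP2y)).trans_eq eM
  have r4x := (step (n2 (chartPlaqCost H x 1 2) (gaussAvg β H (linCurvSq H (plaq12At x))) ev4) ((hmono x 4 ev4).trans hP4x)).trans_eq eQ
  have r4y := (step (n2 (chartPlaqCost H y 1 2) (gaussAvg β H (linCurvSq H (plaq12At y))) ev4) ((hmono y 4 ev4).trans hP4y)).trans_eq eQ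
  have ru2 := (step (n2 (tiltU β H) b ev2) hR2).trans_eq eU2
  have ru4 := (step (n2 (tiltU β H) b ev4) hR4).trans_eq eU4
  have ru6 := (step (n2 (tiltU β H) b ev6) hR6).trans_eq eU6
  have h := (abs_tiltCum5_muSet_tiltU_le (H := H) hβ0 hDm hDpos hB0 hUB ht0 x y
    (gaussAvg β H (linCurvSq H (plaq12At x))) (gaussAvg β H (linCurvSq H (plaq12At y))) b).trans
    (k5_bookkeeping hK0 hKP0 hA0 hSg0 h20 r2x r2y r4x r4y ru2 ru4 ru6)
  -- the prefactor `≤ 112(√C_P + C_P)·Λ²`, `Λ² = e^{4B}`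
  have hpre := k5_prefactor_le hΛ1 hC_P0 hKdef hKPdef
  have hΛ2 : Λ ^ 2 = Real.exp (4 * B) := by rw [hΛ, ← Real.exp_nat_mul]; ring_nf
  rw [hΛ2] at hpre
  have X1 : 0 ≤ ((1 + Real.log (H : ℝ)) ^ 2 / β ^ 2 + s ^ 3 / (β * Real.sqrt β)) * Real.sqrt RU6 := by positivity
  have X2 : 0 ≤ (1 + Real.log (H : ℝ)) ^ 2 / β ^ 2 * (Real.sqrt RU2 * Real.sqrt RU4) := by positivity
  have X3 : 0 ≤ ((1 + Real.log (H : ℝ)) ^ 2 / β ^ 2 + s ^ 3 / (β * Real.sqrt β)) * (RU2 * Real.sqrt RU2) := by positivity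
  have hKK : 0 ≤ KP ^ 2 * K ^ 2 := by positivity
  have hK3 : 0 ≤ K ^ 3 * KP := by positivity
  have hK1 : 0 ≤ KP * K := by positivity
  have c1 : 32 * KP * K ≤ 112 * (Real.sqrt C_P + C_P) * Real.exp (4 * B) := by linarith only [hKK, hK3, hpre]
  have c2 : 28 * KP ^ 2 * K ^ 2 ≤ 112 * (Real.sqrt C_P + C_P) * Real.exp (4 * B) := by linarith only [hK1, hK3, hpre]
  have c3 : 12 * K ^ 3 * KP ≤ 112 * (Real.sqrt C_P + C_P) * Real.exp (4 * B) := by linarith only [hK1, hKK, hpre]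
  calc _ ≤ _ := h
    _ ≤ 112 * (Real.sqrt C_P + C_P) * Real.exp (4 * B) * (((1 + Real.log (H : ℝ)) ^ 2 / β ^ 2 + s ^ 3 / (β * Real.sqrt β)) * Real.sqrt RU6) +
        112 * (Real.sqrt C_P + C_P) * Real.exp (4 * B) * ((1 + Real.log (H : ℝ)) ^ 2 / β ^ 2 * (Real.sqrt RU2 * Real.sqrt RU4)) +
        112 * (Real.sqrt C_P + C_P) * Real.exp (4 * B) * (((1 + Real.log (H : ℝ)) ^ 2 / β ^ 2 + s ^ 3 / (β * Real.sqrt β)) * (RU2 * Real.sqrt RU2)) :=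
        add_le_add_three (mul_le_mul_of_nonneg_right c1 X1) (mul_le_mul_of_nonneg_right c2 X2) (mul_le_mul_of_nonneg_right c3 X3)
    _ = _ := by ring

end GaussNormalForm

end Summit.QuantumFields.YangMills.Theorems.AllWindowsColdBoxBoxHighLine

end
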